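import Literature.NumberTheory.Automorphic.BianchiCuspIdealClasses
import HarnessLib

/-!
# Cusp coordinates, unipotent translations and the prototypes of the cover (definitions)

Topic `NumberTheory/Automorphic`; namespace `Literature.NumberTheory.Automorphic`, grouping
sub-namespace `BianchiCusp`.  Definitions with body and the theorems needed to state them;
sequel of `BianchiCuspIdealClasses`.  This file carries ALL the remaining definitions of the
reduction theory of `GL₂(𝓞_K)` on the cone of binary Hermitian forms (its sequels
`BianchiCuspClasses`, `BianchiCuspStabilizer(Finite)`, `BianchiDirichlet`,
`BianchiFundamentalSet`, `BianchiLocalFiniteness`, `BianchiPrototypes`, `BianchiCover`,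
`BianchiCohomologyFinite` are theorems only): the cusp equivalence `CuspRel`
(`x v = y (γ w)`), the coordinates `coords M = (Re M₀₀, Re M₁₁, M₀₁)` with inverse `hermForm`,
the thick boxes `thickBox q ε = coords⁻¹(ball q ε)`, cones over sets `coneOver`, the normalised
forms `paramForm (p, z) = (p z; z̄ (1+|z|²)/p)`, and at a cusp `u`: `compl`, `cuspMatK`, `cuspGL`,
`cuspForm`, `hcoord`, `transl`, `conjElt` (`g_u⁻¹ σ(π) g_u`) and the cusp boxes
`cuspBox σ hu δ = {H ∈ 𝒫 | depth_u H < 1, |w_u(H)| < δ}`.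

For a non-zero integral vector `u = (a, b)` of the imaginary quadratic field `K` choose a
unimodular completion `(c, d)`, `a d - b c = 1`, `c, d ∈ 𝔞_u⁻¹` (`compl`, from
`exists_det_eq_one_of_mem_inv`) and let `g_u = (a c; b d) ∈ SL₂(K) ⊂ GL₂(ℂ)` (`cuspGL`): it
moves the standard cusp `e₀` to `u`.  The CUSP FORM of `H` is `H_u = g_uᴴ H g_u = g_u⁻¹ • H`
(`cuspForm`; its corner is `H[σ u]`, `cuspForm_zero_zero`) and the HORIZONTAL (horospherical)
COORDINATE is `w_u(H) = (H_u)₀₁ / (H_u)₀₀ ∈ ℂ` (`hcoord`; homogeneous of degree `0` and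
continuous on the cone) — the upper half-space coordinates attached to the cusp `u`
([ElstrodtGrunewaldMennicke1998, Ch. 1 §1.1, Ch. 7 §7.2–7.3]; [Swan1971, §3]).  The UNIPOTENT
TRANSLATIONS at `u` are the matrices

  `T_u(x) = g_u (1 x; 0 1) g_u⁻¹ = (1 - xab  xa²; -xb²  1 + xab) ∈ SL₂(𝓞_K)`   (`x ∈ 𝓞_K`)

(`transl`), which fix `u` (`transl_mulVec`), preserve the depth at `u`, and TRANSLATE the
horizontal coordinate: `w_u(T_u(x) • H) = w_u(H) - σ x` (`hcoord_transl`).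

## References

* J. Elstrodt, F. Grunewald, J. Mennicke, *Groups Acting on Hyperbolic Space* (1998), Ch. 1
  §1.1, Ch. 7 §7.2–7.3 [ElstrodtGrunewaldMennicke1998].
* R. G. Swan, Adv. Math. 6 (1971), §3 [Swan1971].
-/

noncomputable section

open Matrix Complex NumberField
open scoped MatrixGroups ComplexConjugate

namespace Literature.NumberTheory.Automorphic

namespace BianchiCusp

open BianchiCone Literature.NumberTheory.NumberFields

variable {K : Type*} [Field K] [NumberField K] (σ : K →+* ℂ)

/-! ### The cusp equivalence -/

omit [NumberField K] in
/-- **Cusp equivalence** of integral vectors: `v ~ w` iff `x v = y (γ w)` for some `γ ∈ GL₂(𝓞_K)`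
and non-zero scalars `x, y ∈ 𝓞_K` (the lines of `v` and `γ w` coincide).
[cite: ElstrodtGrunewaldMennicke1998, Ch. 7 §7.2] -/
def CuspRel (v w : OVec K) : Prop :=
  ∃ (γ : GL (Fin 2) (𝓞 K)) (x y : 𝓞 K), x ≠ 0 ∧ y ≠ 0 ∧ x • v = y • ((γ : Matrix (Fin 2) (Fin 2) (𝓞 K)) *ᵥ w)

/-! ### Coordinates on binary Hermitian forms, boxes and cones over sets -/

/-- **`(p, r, z) ↦ (p z; z̄ r)`.** [folklore] -/
def hermForm (q : ℝ × ℝ × ℂ) : Mat :=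
  !![(q.1 : ℂ), q.2.2; conj q.2.2, (q.2.1 : ℂ)]

/-- **The coordinates** `(Re M₀₀, Re M₁₁, M₀₁)` of a binary Hermitian form. [folklore] -/
def coords (M : Mat) : ℝ × ℝ × ℂ :=
  ((M 0 0).re, (M 1 1).re, M 0 1)

/-- **The thick box** `coords⁻¹(ball q ε)`. [cite: ElstrodtGrunewaldMennicke1998, Ch. 2 §2.2] -/
def thickBox (q : ℝ × ℝ × ℂ) (ε : ℝ) : Set Mat :=
  coords ⁻¹' Metric.ball q ε

/-- **The cone over a set**: `{M | t M ∈ B for some t > 0}`. [folklore] -/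
def coneOver (B : Set Mat) : Set Mat :=
  {M | ∃ t : ℝ, 0 < t ∧ t • M ∈ B}

/-- **The normalised Hermitian form** `(p z; z̄ (1+|z|²)/p)` of determinant `1`.
[cite: ElstrodtGrunewaldMennicke1998, Ch. 7 §7.3] -/
def paramForm (q : ℝ × ℂ) : Mat :=
  !![(q.1 : ℂ), q.2; conj q.2, (((1 + Complex.normSq q.2) / q.1 : ℝ) : ℂ)]

/-! ### Elements of `GL₂(ℂ)` of determinant one -/

/-- An element of `GL₂(ℂ)` from a matrix of determinant `1`. [folklore] -/
def glOfDetOne (M : Mat) (h : M.det = 1) : GL (Fin 2) ℂ :=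
  Matrix.SpecialLinearGroup.toGL (⟨M, h⟩ : SpecialLinearGroup (Fin 2) ℂ)

/-- The underlying matrix of `glOfDetOne`. [folklore] -/
@[simp]
theorem coe_glOfDetOne (M : Mat) (h : M.det = 1) : (glOfDetOne M h : Mat) = M := rfl

/-- The inverse of `glOfDetOne` is the adjugate. [folklore] -/
theorem coe_glOfDetOne_inv (M : Mat) (h : M.det = 1) :
    ((glOfDetOne M h)⁻¹ : GL (Fin 2) ℂ) = (M.adjugate : Mat) := by
  rw [glOfDetOne, ← map_inv, Matrix.SpecialLinearGroup.coe_GL_coe_matrix, Matrix.SpecialLinearGroup.coe_inv]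

/-- The unipotent matrix `(1 y; 0 1)`. [folklore] -/
def unip (y : ℂ) : GL (Fin 2) ℂ :=
  glOfDetOne !![1, y; 0, 1] (by simp [det_fin_two])

/-- The underlying matrix of `unip y`. [folklore] -/
@[simp]
theorem coe_unip (y : ℂ) : (unip y : Mat) = !![1, y; 0, 1] := rfl

/-- `(unip y)⁻¹ = unip (-y)`. [folklore] -/
theorem unip_inv (y : ℂ) : (unip y)⁻¹ = unip (-y) := by
  rw [inv_eq_iff_mul_eq_one]
  apply Units.ext
  simp only [Units.val_mul, coe_unip, Units.val_one]
  ext i j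
  fin_cases i <;> fin_cases j <;> simp

/-- **The action of a unipotent translation on a form**: corner unchanged, next entry shifted.
[cite: ElstrodtGrunewaldMennicke1998, Ch. 1 §1.1] -/
theorem act_unip_apply (y : ℂ) (M : Mat) :
    act (unip y) M 0 0 = M 0 0 ∧ act (unip y) M 0 1 = M 0 1 - y * M 0 0 := by
  rw [act, unip_inv, coe_unip]
  constructor
  · simp [Matrix.mul_apply, Fin.sum_univ_two, conjTranspose_apply]
  · simp [Matrix.mul_apply, Fin.sum_univ_two, conjTranspose_apply]
    ring

/-! ### The completion and the cusp matrix -/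

section Cusp

variable {u : OVec K} (hu : u ≠ 0)

/-- **A unimodular completion** `(c, d)` of `u = (a, b)`: `a d - b c = 1`, `c, d ∈ 𝔞_u⁻¹`.
[cite: ElstrodtGrunewaldMennicke1998, Ch. 7 §7.2] -/
def compl : K × K :=
  ((exists_det_eq_one_of_mem_inv hu).choose, (exists_det_eq_one_of_mem_inv hu).choose_spec.choose)

/-- The defining properties of the completion. [folklore] -/
theorem compl_spec :
    (compl hu).1 ∈ ((idealOf u : FractionalIdeal (nonZeroDivisors (𝓞 K)) K))⁻¹ ∧
      (compl hu).2 ∈ ((idealOf u : FractionalIdeal (nonZeroDivisors (𝓞 K)) K))⁻¹ ∧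
      (u 0 : K) * (compl hu).2 - (u 1 : K) * (compl hu).1 = 1 :=
  (exists_det_eq_one_of_mem_inv hu).choose_spec.choose_spec

/-- **The cusp matrix** `(a c; b d)` over `K`. [cite: ElstrodtGrunewaldMennicke1998, Ch. 7 §7.2] -/
def cuspMatK : Matrix (Fin 2) (Fin 2) K :=
  !![(u 0 : K), (compl hu).1; (u 1 : K), (compl hu).2]

/-- The cusp matrix has determinant `1`. [folklore] -/
theorem det_cuspMatK : (cuspMatK hu).det = 1 := by
  rw [cuspMatK, det_fin_two_of]
  have h := (compl_spec hu).2.2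
  linear_combination h

/-- Its image under `σ` has determinant `1`. [folklore] -/
theorem det_map_cuspMatK : (σ.mapMatrix (cuspMatK hu)).det = 1 := by
  rw [← RingHom.map_det, det_cuspMatK, map_one]

/-- **`g_u ∈ GL₂(ℂ)`**, moving `e₀` to `σ u`. [cite: ElstrodtGrunewaldMennicke1998, Ch. 7 §7.2] -/
def cuspGL : GL (Fin 2) ℂ :=
  glOfDetOne (σ.mapMatrix (cuspMatK hu)) (det_map_cuspMatK σ hu)

/-- Entries of `g_u`. [folklore] -/
theorem coe_cuspGL : (cuspGL σ hu : Mat) = !![σ (u 0 : K), σ (compl hu).1; σ (u 1 : K), σ (compl hu).2] := by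
  rw [cuspGL, coe_glOfDetOne, cuspMatK]
  ext i j
  fin_cases i <;> fin_cases j <;> rfl

/-- Entries of `g_u⁻¹` (the adjugate). [folklore] -/
theorem coe_cuspGL_inv : ((cuspGL σ hu)⁻¹ : GL (Fin 2) ℂ) =
    (!![σ (compl hu).2, -σ (compl hu).1; -σ (u 1 : K), σ (u 0 : K)] : Mat) := by
  rw [cuspGL, coe_glOfDetOne_inv, adjugate_fin_two]
  ext i j
  fin_cases i <;> fin_cases j <;> rfl

/-- `g_u e₀ = σ u`. [folklore] -/
theorem cuspGL_mulVec_single : (cuspGL σ hu : Mat) *ᵥ Pi.single 0 1 = emb σ u := by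
  rw [coe_cuspGL]
  funext i
  fin_cases i <;> simp [mulVec, emb]

/-! ### The cusp form and the horizontal coordinate -/

/-- **The cusp form** `H_u = g_uᴴ H g_u = g_u⁻¹ • H`. [cite: ElstrodtGrunewaldMennicke1998, Ch. 7 §7.3] -/
def cuspForm (H : Mat) : Mat :=
  act (cuspGL σ hu)⁻¹ H

/-- **The horizontal coordinate** `w_u(H) = (H_u)₀₁ / (H_u)₀₀`. [cite: ElstrodtGrunewaldMennicke1998, Ch. 7 §7.3] -/
def hcoord (H : Mat) : ℂ :=
  cuspForm σ hu H 0 1 / cuspForm σ hu H 0 0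

/-- The corner of the cusp form is `H[σ u]`. [folklore] -/
theorem re_cuspForm_zero_zero (H : Mat) : (cuspForm σ hu H 0 0).re = qf H (emb σ u) := by
  rw [← qf_single_zero, cuspForm, qf_act, inv_inv, cuspGL_mulVec_single]

/-- For Hermitian `H` the corner of the cusp form is the real number `H[σ u]`. [folklore] -/
theorem cuspForm_zero_zero {H : Mat} (hH : H.IsHermitian) :
    cuspForm σ hu H 0 0 = (qf H (emb σ u) : ℂ) := by
  apply Complex.ext
  · rw [re_cuspForm_zero_zero, Complex.ofReal_re]
  · rw [Complex.ofReal_im]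
    exact im_apply_self_of_isHermitian (isHermitian_act _ hH) 0

/-- On the cone the corner of the cusp form is non-zero. [folklore] -/
theorem cuspForm_zero_zero_ne_zero {H : Mat} (hH : H ∈ cone) : cuspForm σ hu H 0 0 ≠ 0 := by
  rw [cuspForm_zero_zero σ hu hH.1, Complex.ofReal_ne_zero]
  exact (qf_pos hH fun h => hu ((emb_eq_zero_iff σ).1 h)).ne'

/-- The cusp form is linear: `(t H)_u = t H_u`. [folklore] -/
theorem cuspForm_smul (t : ℝ) (H : Mat) : cuspForm σ hu (t • H) = t • cuspForm σ hu H :=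
  act_smul _ t H

/-- **Homogeneity**: `w_u(t H) = w_u(H)` for `t ≠ 0`. [folklore] -/
theorem hcoord_smul {t : ℝ} (ht : t ≠ 0) (H : Mat) : hcoord σ hu (t • H) = hcoord σ hu H := by
  rw [hcoord, hcoord, cuspForm_smul, Matrix.smul_apply, Matrix.smul_apply, Complex.real_smul,
    Complex.real_smul, mul_div_mul_left _ _ (Complex.ofReal_ne_zero.2 ht)]

/-- The cusp form is continuous. [folklore] -/
theorem continuous_cuspForm : Continuous (cuspForm σ hu) :=
  continuous_act _

/-- **The horizontal coordinate is continuous on the cone.** [folklore] -/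
theorem continuousOn_hcoord : ContinuousOn (hcoord σ hu) cone := by
  have hc : ∀ i j : Fin 2, Continuous fun H : Mat => cuspForm σ hu H i j := fun i j =>
    (continuous_apply j).comp ((continuous_apply i).comp (continuous_cuspForm σ hu))
  exact ((hc 0 1).continuousOn).div (hc 0 0).continuousOn fun H hH => cuspForm_zero_zero_ne_zero σ hu hH

/-! ### Unipotent translations -/

/-- **The unipotent translation** `T_u(x) = (1 - xab, xa²; -xb², 1 + xab) ∈ SL₂(𝓞_K)`.
[cite: ElstrodtGrunewaldMennicke1998, Ch. 7 §7.3] -/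
def transl (u : OVec K) (x : 𝓞 K) : GL (Fin 2) (𝓞 K) :=
  Matrix.SpecialLinearGroup.toGL
    (⟨!![1 - x * u 0 * u 1, x * u 0 ^ 2; -(x * u 1 ^ 2), 1 + x * u 0 * u 1], by
      rw [det_fin_two_of]; ring⟩ : SpecialLinearGroup (Fin 2) (𝓞 K))

omit [NumberField K] in
/-- Entries of `T_u(x)`. [folklore] -/
theorem coe_transl (u : OVec K) (x : 𝓞 K) : (transl u x : Matrix (Fin 2) (Fin 2) (𝓞 K)) =
    !![1 - x * u 0 * u 1, x * u 0 ^ 2; -(x * u 1 ^ 2), 1 + x * u 0 * u 1] := rfl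

omit [NumberField K] in
/-- **`T_u(x)` fixes `u`.** [cite: ElstrodtGrunewaldMennicke1998, Ch. 7 §7.3] -/
theorem transl_mulVec (u : OVec K) (x : 𝓞 K) : (transl u x : Matrix (Fin 2) (Fin 2) (𝓞 K)) *ᵥ u = u := by
  rw [coe_transl]
  funext i
  fin_cases i
  · simp [mulVec, dotProduct, Fin.sum_univ_two]; ring
  · simp [mulVec, dotProduct, Fin.sum_univ_two]; ring

/-- **`σ(T_u(x)) = g_u (1 σx; 0 1) g_u⁻¹`.** [cite: ElstrodtGrunewaldMennicke1998, Ch. 7 §7.3] -/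
theorem toGL_transl (x : 𝓞 K) :
    toGL σ (transl u x) = cuspGL σ hu * unip (σ x) * (cuspGL σ hu)⁻¹ := by
  apply Units.ext
  rw [Units.val_mul, Units.val_mul, coe_cuspGL, coe_cuspGL_inv, coe_unip]
  ext i j
  rw [toGL_apply, coe_transl]
  have h := (compl_spec hu).2.2
  have h' : σ (u 0 : K) * σ (compl hu).2 - σ (u 1 : K) * σ (compl hu).1 = 1 := by
    rw [← map_mul, ← map_mul, ← map_sub, h, map_one]
  fin_cases i <;> fin_cases j
  · simp [Matrix.mul_apply, Fin.sum_univ_two, ← RingOfIntegers.coe_eq_algebraMap]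
    linear_combination (-1 : ℂ) * h'
  · simp [Matrix.mul_apply, Fin.sum_univ_two, ← RingOfIntegers.coe_eq_algebraMap]
    ring
  · simp [Matrix.mul_apply, Fin.sum_univ_two, ← RingOfIntegers.coe_eq_algebraMap]
    ring
  · simp [Matrix.mul_apply, Fin.sum_univ_two, ← RingOfIntegers.coe_eq_algebraMap]
    linear_combination (-1 : ℂ) * h'

/-- The cusp form of a translate: `(T_u(x) • H)_u = (1 σx; 0 1) • H_u`. [folklore] -/
theorem cuspForm_act_transl (x : 𝓞 K) (H : Mat) :
    cuspForm σ hu (act (toGL σ (transl u x)) H) = act (unip (σ x)) (cuspForm σ hu H) := by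
  rw [cuspForm, cuspForm, ← act_mul, ← act_mul, toGL_transl σ hu, ← mul_assoc, ← mul_assoc,
    inv_mul_cancel, one_mul]

/-- **Translations preserve the depth at `u`.** [cite: ElstrodtGrunewaldMennicke1998, Ch. 7 §7.3] -/
theorem depth_act_transl [IsTotallyComplex K] (hK : Module.finrank ℚ K = 2) (x : 𝓞 K) {H : Mat}
    (hH : H.IsHermitian) : depth σ u (act (toGL σ (transl u x)) H) = depth σ u H := by
  have h := depth_mulVec_act σ hK (transl u x) u hH
  rw [transl_mulVec] at h
  exact h

/-- **Translations shift the horizontal coordinate**: `w_u(T_u(x) • H) = w_u(H) - σ x` on the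
cone. [cite: ElstrodtGrunewaldMennicke1998, Ch. 7 §7.3] -/
theorem hcoord_act_transl (x : 𝓞 K) {H : Mat} (hH : H ∈ cone) :
    hcoord σ hu (act (toGL σ (transl u x)) H) = hcoord σ hu H - σ x := by
  have h0 := cuspForm_zero_zero_ne_zero σ hu hH
  rw [hcoord, hcoord, cuspForm_act_transl, (act_unip_apply _ _).1, (act_unip_apply _ _).2]
  field_simp

/-- **`m = g_u⁻¹ σ(π) g_u`**, an element of `GL₂(𝓞_K)` in the coordinates of the cusp `u`.
[cite: ElstrodtGrunewaldMennicke1998, Ch. 7 §7.3] -/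
def conjElt (π : GL (Fin 2) (𝓞 K)) : GL (Fin 2) ℂ :=
  (cuspGL σ hu)⁻¹ * toGL σ π * cuspGL σ hu

/-- **The cusp box** `{H ∈ 𝒫 | depth_u H < 1, |w_u(H)| < δ}`. [cite: ElstrodtGrunewaldMennicke1998, Ch. 7 §7.3] -/
def cuspBox (δ : ℝ) : Set Mat :=
  {H | H ∈ cone ∧ depth σ u H < 1 ∧ ‖hcoord σ hu H‖ < δ}

end Cusp

end BianchiCusp

end Literature.NumberTheory.Automorphic
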